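import Summits.QuantumFields.YangMills.Theorems.BalabanUVNodesN22W1YoungLipschitzOfCouplingHolo
import Literature.MathematicalPhysics.QuantumFieldTheory.Balaban1983to89.T4CouplingAnalyticity

/-!
# BalabanUVNodes ∕ node N22 = NE9 — W1's `YoungLipschitz` SLOT FROM COUPLING HOLOMORPHY, THE VERTEX EDITION: the LAST young coupling on
# RELATIVE discs `|z − s| ≤ c·s` with an activity bound vanishing LINEARLY at the vertex `s → 0` (print's dilation shape of the last
# coupling), the OLDER couplings on uniform margins ⟹ a `g`-INDEPENDENT Lipschitz table on the FULL box `]0, γ]^{k+1}`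

Cell `pub-ymgap`, HUMAN RULING D-0062 (Track A), R134 seat `pub-ymgap-dag-n22-c` (N22 NE9 s1), generation 12, module J31b (sibling of J31
`…N22W1YoungLipschitzOfCouplingHolo` p605695 — kept out of it only by the 400-line cap).  THEOREMS ONLY (0 `def`, 0 `sorry`); imports J31 and the cell's
`Literature.….T4CouplingAnalyticity` (`real_param_lipschitz_relW`: the weighted Cauchy estimate on relative discs, §9 of that module) BY NAME.
Filed `--supports stmt-QuantumFields-20544` (K3⁷) as a HELPER; count-neutral.

WHY.  J31's header carries a VERTEX caveat: in the printed scheme the LAST coupling `g_k` of the step-`k` cluster data is a dilation parameter of the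
integration variables ([II] pp. 12–20; `T4CouplingAnalyticity` located readings (L5)∕[H-dil]; the cell's vertex verdict), so a `g`-independent margin in
the last coordinate is not available down to the vertex `g_k → 0`; what print's shape supports instead is holomorphy on RELATIVE discs `|z − g_k| ≤ c·g_k`
with a bound VANISHING at the vertex (e.g. [DimockYuan2024GNFlow] Cor. 1: activities `O(g_k³)` on `|g′_k − g_k| < g_k`).  `T4CouplingAnalyticity.
real_param_lipschitz_relW` turns «relative discs + a bound `B·s` linear in the coupling» into the Lipschitz constant `8B∕min(c,1)`, which does NOT blow up
at the vertex.  THIS MODULE reads that mechanism at ACTIVITY level for ONE coordinate (§1) and assembles the W1 slot on the FULL box of record with the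
last coordinate so treated and the older ones on J31's uniform margins (§2) — the caveat becomes a displayed hypothesis of printed shape.

WHAT (all [folklore] unless cited).
* §1 `norm_sub_update_le_of_coordHoloRel` — ONE REAL COUPLING AT THE VERTEX: base point `g` with `g_i ∈ ]0, γ]`, `Fc` holomorphic on `O ⊇` the closed
  relative discs `D̄(s, c·s)`, `s ∈ ]0, γ]`, `‖Fc‖ ≤ B·s` on `D̄(s, c·s)`, `Fc s = f (g|g_i := s)` ⟹ `‖f g − f (g|g_i := t)‖ ≤ (8B∕min(c,1))·|g_i − t|` for
  `t ∈ ]0, γ]` (`real_param_lipschitz_relW` on `[min, max] ⊆ ]0, γ]`, both orders).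
* §2 W1 INSTANCES on the box of record `W1.box γ k`: `bound238_box_of_coordHoloLast` (the relative last-coupling datum alone ⟹ `Bound238 (box γ k) sp (A′γ) R`,
  evaluation at the real point); ★ `youngLipschitz_box_of_coordHolo_vertex` (OLDER coordinates `i < k`: J31's uniform-margin datum, radii `ρ i`, bound
  `A·e^{−R d}`; LAST coordinate: relative discs `c·s`, bound `A′·s·e^{−R d}` ⟹ `YoungLipschitz (box γ k) sp ℓ R` with the `g`-INDEPENDENT table
  `ℓ i = if i < k then 4A∕ρ i else 8A′∕min(c,1)`); `youngLipschitz_box_of_coordHoloRel` (EVERY coordinate on relative discs with linear weight — the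
  uniform shape `T4CouplingAnalyticity.CouplingAnalyticRelW … (fun s ↦ s)` read at activity level ⟹ table `fun _ ↦ 8A′∕min(c,1)`).
* §3 RIDER (A5): `coordHoloRel_termlessStep` — the relative datum is satisfiable (termless model step, `Hc ≡ 0`).

HONEST FRAMING.  Count-neutral helper; by-name Cauchy bridge at the OBJECT.  Both data (uniform margins in the older couplings, relative discs with linear
vanishing in the last) are DISPLAYED hypotheses asserted nowhere — node N10's Lemma 3 T-row complexified in the couplings ∕ NODE A at the towers of record;
whether Bałaban's activities vanish linearly (or as a power, cf. `couplingAnalyticRelW_lin_of_pow`) at the vertex is THEIR content, read here only as a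
shape.  Nothing of Bałaban's constructed; N22 NOT discharged (typed 28∕28 · discharged 5∕27 UNCHANGED); NE9 NOT IN PRINT for d = 4; one finite four-torus
programme at fixed ε — NOT infinite volume, NOT OS on ℝ⁴, NOT a mass gap, NOT Clay.  0 `sorry`, 0 `def`, standard axioms.

References (TYPES only): [I] = [Balaban1987RG1] T. Bałaban, Commun. Math. Phys. **109** (1987) 249–301 — §1 p. 263 («C^∞ … (or analytic)»), p. 266;
[II] = [Balaban1988RG2Cluster] T. Bałaban, Commun. Math. Phys. **116** (1988) 1–22 — (2.5)–(2.10) pp. 12–14 (the dilation `B = g_k B′`), Lemma 3 (2.38)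
p. 20; the weighted Cauchy mechanism is [DimockYuan2024GNFlow] Cor. 1 as typed in `T4CouplingAnalyticity` §9.
-/

noncomputable section

namespace YMDAG.N22.W1

open Set Metric
open scoped BigOperators
open Literature.MathematicalPhysics.QuantumFieldTheory.Balaban1983to89
open Literature.MathematicalPhysics.QuantumFieldTheory.Balaban1983to89.Node00
open Literature.MathematicalPhysics.QuantumFieldTheory.Balaban1983to89.Node00.Sect2 (domSys CPair)
open Literature.MathematicalPhysics.QuantumFieldTheory.Balaban1983to89.Node00.W1
open Literature.MathematicalPhysics.QuantumFieldTheory.Balaban1983to89.T4CouplingAnalyticity (real_param_lipschitz_relW)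

/-! ## §1 ONE REAL COUPLING AT THE VERTEX: relative discs with a linearly vanishing bound ⟹ a bounded Lipschitz letter -/

/-- **CAUCHY ON RELATIVE DISCS (one coupling, activity level).**  A base point `g` with `g_i ∈ ]0, γ]`; `Fc` holomorphic on `O ⊇ D̄(s, c·s)` for every
`s ∈ ]0, γ]`, bounded by `B·s` on `D̄(s, c·s)`, agreeing with `t ↦ f (g|g_i := t)` on `]0, γ]`: then `‖f g − f (g|g_i := t)‖ ≤ (8B∕min(c,1))·|g_i − t|` for
`t ∈ ]0, γ]` — `T4CouplingAnalyticity.real_param_lipschitz_relW` on the segment between the two couplings (both orders). [cite: DimockYuan2024GNFlow, Corollary 1 and its proof] -/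
theorem norm_sub_update_le_of_coordHoloRel {n : ℕ} {F : Type*} [NormedAddCommGroup F] [NormedSpace ℂ F] [CompleteSpace F]
    (f : (Fin n → ℝ) → F) {γ c B : ℝ} (hc : 0 < c) (g : Fin n → ℝ) (i : Fin n) (hgi : g i ∈ Ioc (0 : ℝ) γ)
    (Fc : ℂ → F) (O : Set ℂ) (hhol : DifferentiableOn ℂ Fc O) (hdisc : ∀ s ∈ Ioc (0 : ℝ) γ, closedBall (s : ℂ) (c * s) ⊆ O)
    (hB : ∀ s ∈ Ioc (0 : ℝ) γ, ∀ z ∈ closedBall (s : ℂ) (c * s), ‖Fc z‖ ≤ B * s)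
    (hrep : ∀ s ∈ Ioc (0 : ℝ) γ, Fc s = f (Function.update g i s)) {t : ℝ} (ht : t ∈ Ioc (0 : ℝ) γ) :
    ‖f g - f (Function.update g i t)‖ ≤ 8 * B / min c 1 * |g i - t| := by
  have key : ∀ a b : ℝ, a ∈ Ioc (0 : ℝ) γ → b ∈ Ioc (0 : ℝ) γ → a ≤ b → ‖Fc a - Fc b‖ ≤ 8 * B / min c 1 * |a - b| := by
    intro a b ha hb hab
    have hI : Icc a b ⊆ Ioc (0 : ℝ) γ := fun s hs => ⟨ha.1.trans_le hs.1, hs.2.trans hb.2⟩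
    exact real_param_lipschitz_relW ha.1 hab hc hhol (fun s hs => hdisc s (hI hs)) (fun s hs z hz => hB s (hI hs) z hz)
  rcases le_total (g i) t with h | h
  · have h1 := key (g i) t hgi ht h
    rwa [hrep _ hgi, hrep _ ht, Function.update_eq_self] at h1
  · have h1 := key t (g i) ht hgi h
    rw [hrep _ ht, hrep _ hgi, Function.update_eq_self, norm_sub_rev, abs_sub_comm] at h1
    exact h1

/-! ## §2 W1 INSTANCES on the box of record: the last coupling at the vertex, the older ones on uniform margins -/

section W1
variable {P : Params} {𝔸 : Type*} {M k : ℕ}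

/-- **`Bound238` FROM THE RELATIVE LAST-COUPLING DATUM ALONE** (evaluation at the real point `s = g_k`; `A′·g_k ≤ A′·γ` on the box).
[cite: Balaban1988RG2Cluster, Lemma 3 (2.38) p.20] -/
theorem bound238_box_of_coordHoloLast (S : ClusterStep P 𝔸 M k) {γ : ℝ} (sp : (domSys P M (k + 1)).Dom → Set (CPair P 𝔸))
    {A' R c : ℝ} (hA' : 0 ≤ A') (hc : 0 < c)
    (hLast : ∀ g ∈ box γ k, ∀ Z, ∀ φ ∈ sp Z,
      ∃ (Hc : ℂ → ℂ) (O : Set ℂ), DifferentiableOn ℂ Hc O ∧ (∀ s ∈ Ioc (0 : ℝ) γ, closedBall (s : ℂ) (c * s) ⊆ O) ∧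
        (∀ s ∈ Ioc (0 : ℝ) γ, ∀ z ∈ closedBall (s : ℂ) (c * s), ‖Hc z‖ ≤ A' * s * Real.exp (-(R * (domSys P M (k + 1)).dj Z))) ∧
        (∀ t ∈ Ioc (0 : ℝ) γ, Hc t = S.H (Function.update g (Fin.last k) t) φ Z)) :
    S.Bound238 (box γ k) sp (A' * γ) R := by
  intro g hg Z φ hφ
  obtain ⟨Hc, O, -, -, hB, hrep⟩ := hLast g hg Z φ hφ
  have hgk : g (Fin.last k) ∈ Ioc (0 : ℝ) γ := hg (Fin.last k)
  have h1 := hB _ hgk _ (mem_closedBall_self (mul_nonneg hc.le hgk.1.le))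
  rw [hrep _ hgk, Function.update_eq_self] at h1
  refine h1.trans ?_
  have he : 0 ≤ Real.exp (-(R * (domSys P M (k + 1)).dj Z)) := Real.exp_nonneg _
  calc A' * g (Fin.last k) * Real.exp (-(R * (domSys P M (k + 1)).dj Z))
      ≤ A' * γ * Real.exp (-(R * (domSys P M (k + 1)).dj Z)) :=
        mul_le_mul_of_nonneg_right (mul_le_mul_of_nonneg_left hgk.2 hA') he

/-- **★ THE VERTEX EDITION OF THE SLOT.**  On the box `]0, γ]^{k+1}`: the OLDER coordinates `i < k` carry J31's uniform-margin datum (radii `ρ i`, bound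
`A·e^{−R d_{k+1}(Z)}`), the LAST coordinate carries the relative datum (discs `D̄(s, c·s)`, bound `A′·s·e^{−R d_{k+1}(Z)}`) ⟹ W1's
`YoungLipschitz (box γ k) sp ℓ R` with the `g`-INDEPENDENT table `ℓ i = if i < k then 4A∕ρ i else 8A′∕min(c,1)` (J31 `youngLipschitz_of_coordLipschitz` fed
coordinate by coordinate: `norm_sub_update_le_of_coordHolo` for `i < k`, §1 for `i = k`).
[cite: Balaban1987RG1, §1 p.263 and §2 p.266; Balaban1988RG2Cluster, (2.5)-(2.10) pp.12-14 and Lemma 3 (2.38) p.20] -/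
theorem youngLipschitz_box_of_coordHolo_vertex (S : ClusterStep P 𝔸 M k) {γ : ℝ} (sp : (domSys P M (k + 1)).Dom → Set (CPair P 𝔸))
    {A A' R c : ℝ} (ρ : Fin (k + 1) → ℝ) (hρ : ∀ i, 0 < ρ i) (hc : 0 < c)
    (hOld : ∀ g ∈ box γ k, ∀ Z, ∀ φ ∈ sp Z, ∀ i : Fin (k + 1), (i : ℕ) < k →
      ∃ (Hc : ℂ → ℂ) (O : Set ℂ), DifferentiableOn ℂ Hc O ∧ (∀ t ∈ Ioc (0 : ℝ) γ, closedBall (t : ℂ) (ρ i) ⊆ O) ∧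
        (∀ z ∈ O, ‖Hc z‖ ≤ A * Real.exp (-(R * (domSys P M (k + 1)).dj Z))) ∧
        (∀ t ∈ Ioc (0 : ℝ) γ, Hc t = S.H (Function.update g i t) φ Z))
    (hLast : ∀ g ∈ box γ k, ∀ Z, ∀ φ ∈ sp Z,
      ∃ (Hc : ℂ → ℂ) (O : Set ℂ), DifferentiableOn ℂ Hc O ∧ (∀ s ∈ Ioc (0 : ℝ) γ, closedBall (s : ℂ) (c * s) ⊆ O) ∧
        (∀ s ∈ Ioc (0 : ℝ) γ, ∀ z ∈ closedBall (s : ℂ) (c * s), ‖Hc z‖ ≤ A' * s * Real.exp (-(R * (domSys P M (k + 1)).dj Z))) ∧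
        (∀ t ∈ Ioc (0 : ℝ) γ, Hc t = S.H (Function.update g (Fin.last k) t) φ Z)) :
    S.YoungLipschitz (box γ k) sp (fun i => if (i : ℕ) < k then 4 * A / ρ i else 8 * A' / min c 1) R := by
  rw [box_eq_setOf_mem_Ioc]
  refine youngLipschitz_of_coordLipschitz S (fun _ => Ioc (0 : ℝ) γ) sp _ R fun g hg Z φ hφ i t ht => ?_
  by_cases hi : (i : ℕ) < k
  · obtain ⟨Hc, O, hhol, hdisc, hB, hrep⟩ := hOld g hg Z φ hφ i hi
    have key := norm_sub_update_le_of_coordHolo (fun g => S.H g φ Z) Set.ordConnected_Ioc (hρ i) g i (hg i)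
      Hc O hhol hdisc hB hrep ht
    rw [if_pos hi]
    calc ‖S.H g φ Z - S.H (Function.update g i t) φ Z‖
        ≤ 4 * (A * Real.exp (-(R * (domSys P M (k + 1)).dj Z))) / ρ i * |g i - t| := key
      _ = Real.exp (-(R * (domSys P M (k + 1)).dj Z)) * (4 * A / ρ i) * |g i - t| := by ring
  · obtain rfl : i = Fin.last k := Fin.eq_last_of_not_lt hi
    obtain ⟨Hc, O, hhol, hdisc, hB, hrep⟩ := hLast g hg Z φ hφ
    have key := norm_sub_update_le_of_coordHoloRel (fun g => S.H g φ Z) hc g (Fin.last k) (hg _) Hc O hhol hdisc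
      (B := A' * Real.exp (-(R * (domSys P M (k + 1)).dj Z))) (fun s hs z hz => (hB s hs z hz).trans_eq (by ring)) hrep ht
    rw [if_neg hi]
    calc ‖S.H g φ Z - S.H (Function.update g (Fin.last k) t) φ Z‖
        ≤ 8 * (A' * Real.exp (-(R * (domSys P M (k + 1)).dj Z))) / min c 1 * |g (Fin.last k) - t| := key
      _ = Real.exp (-(R * (domSys P M (k + 1)).dj Z)) * (8 * A' / min c 1) * |g (Fin.last k) - t| := by ring

/-- **EVERY COORDINATE ON RELATIVE DISCS WITH LINEAR WEIGHT** — the activity-level reading of the uniform weighted shape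
`T4CouplingAnalyticity.CouplingAnalyticRelW … c (fun s ↦ s)`: per prefix of the box, polymer, configuration and coordinate `i`, `Hc` holomorphic on
`O ⊇ D̄(s, c·s)` (`s ∈ ]0, γ]`), `‖Hc‖ ≤ A′·s·e^{−R d}` there, `Hc t = H(Z; g|g_i := t; φ)` ⟹ `YoungLipschitz (box γ k) sp (fun _ ↦ 8A′∕min(c,1)) R`.
[cite: Balaban1987RG1, §1 p.263 and §2 p.266; Balaban1988RG2Cluster, Lemma 3 (2.38) p.20] -/
theorem youngLipschitz_box_of_coordHoloRel (S : ClusterStep P 𝔸 M k) {γ : ℝ} (sp : (domSys P M (k + 1)).Dom → Set (CPair P 𝔸))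
    {A' R c : ℝ} (hc : 0 < c)
    (hRel : ∀ g ∈ box γ k, ∀ Z, ∀ φ ∈ sp Z, ∀ i : Fin (k + 1),
      ∃ (Hc : ℂ → ℂ) (O : Set ℂ), DifferentiableOn ℂ Hc O ∧ (∀ s ∈ Ioc (0 : ℝ) γ, closedBall (s : ℂ) (c * s) ⊆ O) ∧
        (∀ s ∈ Ioc (0 : ℝ) γ, ∀ z ∈ closedBall (s : ℂ) (c * s), ‖Hc z‖ ≤ A' * s * Real.exp (-(R * (domSys P M (k + 1)).dj Z))) ∧
        (∀ t ∈ Ioc (0 : ℝ) γ, Hc t = S.H (Function.update g i t) φ Z)) :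
    S.YoungLipschitz (box γ k) sp (fun _ => 8 * A' / min c 1) R := by
  rw [box_eq_setOf_mem_Ioc]
  refine youngLipschitz_of_coordLipschitz S (fun _ => Ioc (0 : ℝ) γ) sp _ R fun g hg Z φ hφ i t ht => ?_
  obtain ⟨Hc, O, hhol, hdisc, hB, hrep⟩ := hRel g hg Z φ hφ i
  have key := norm_sub_update_le_of_coordHoloRel (fun g => S.H g φ Z) hc g i (hg i) Hc O hhol hdisc
    (B := A' * Real.exp (-(R * (domSys P M (k + 1)).dj Z))) (fun s hs z hz => (hB s hs z hz).trans_eq (by ring)) hrep ht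
  calc ‖S.H g φ Z - S.H (Function.update g i t) φ Z‖
      ≤ 8 * (A' * Real.exp (-(R * (domSys P M (k + 1)).dj Z))) / min c 1 * |g i - t| := key
    _ = Real.exp (-(R * (domSys P M (k + 1)).dj Z)) * (8 * A' / min c 1) * |g i - t| := by ring

end W1

/-! ## §3 RIDER (A5): the relative datum is satisfiable -/

section Rider
variable {P : Params} {𝔸 : Type*} {M k : ℕ}

/-- **NON-VACUITY (A5 rider).**  The termless MODEL step carries the relative datum in every coordinate with `Hc ≡ 0`, `O = ℂ`, for every `A′ ≥ 0` —
so §2 is not a vacuous implication.  A model step, NOT NODE 00's. [folklore] -/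
theorem coordHoloRel_termlessStep {γ : ℝ} (sp : (domSys P M (k + 1)).Dom → Set (CPair P 𝔸)) {A' : ℝ} (hA' : 0 ≤ A') (R c : ℝ) :
    ∀ g ∈ box γ k, ∀ Z, ∀ φ ∈ sp Z, ∀ i : Fin (k + 1),
      ∃ (Hc : ℂ → ℂ) (O : Set ℂ), DifferentiableOn ℂ Hc O ∧ (∀ s ∈ Ioc (0 : ℝ) γ, closedBall (s : ℂ) (c * s) ⊆ O) ∧
        (∀ s ∈ Ioc (0 : ℝ) γ, ∀ z ∈ closedBall (s : ℂ) (c * s), ‖Hc z‖ ≤ A' * s * Real.exp (-(R * (domSys P M (k + 1)).dj Z))) ∧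
        (∀ t ∈ Ioc (0 : ℝ) γ, Hc t = (⟨PUnit, fun _ => ∅, fun _ _ _ => 0⟩ : ClusterStep P 𝔸 M k).H (Function.update g i t) φ Z) := by
  intro g _ Z φ _ i
  refine ⟨fun _ => 0, univ, differentiableOn_const 0, fun _ _ => subset_univ _, fun s hs z _ => ?_, fun t _ => ?_⟩
  · simp only [norm_zero]
    exact mul_nonneg (mul_nonneg hA' hs.1.le) (Real.exp_nonneg _)
  · simp [ClusterStep.H]

end Rider

end YMDAG.N22.W1

end
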